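/-
Copyright (c) 2026 the pub-hodgecm-mathlib formalisation cell (harness21).  Prover seat hodgecm-mathlib-F0P3-p01 (g32), Track A «(D-RAM) FOUR-FRAME», unit U2H, census leaf
(ρ2b′-X) — T5b «toric level census, type RamK», anisotropic side: the TWISTED norm-depth sets are translates of `B_r` (approximate translator).  2026-09-04.
-/
import Literature.NumberTheory.LocalFields.QuadraticOrderNormTwistClasses   -- ★ p857299 (LH4-p08 (g4)): `B_r`, `v_mul_sub_map_mul_le`, `v_inv_sub_map_inv`, the exact translation lemma
import HarnessLib

/-!
# Twisted norm-depth sets are cosets: `{ω : |ω| = 1, |n₀·ωΘω − ρ(n₀·ωΘω)| ≤ r} = ω₁·B_r` for ANY member `ω₁` (approximate translator)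
(Serre, *Local Fields* Ch. V §1, §3; Jacobowitz 1962 §4)

Topic `NumberTheory/LocalFields`; namespace `Literature.NumberTheory.LocalFields.QuadraticOrder`.  THEOREMS ONLY (no definition, no instance, no notation, no named fact, no
`sorry`); kernel lane `--supports stmt-HodgeConjecture-24833` (count-neutral).  Cell `pub/hodgecm-mathlib` (D-0151), crux H413, Track A, unit U2H, census leaf (ρ2b′-X): TYPE RamK,
ANISOTROPIC side of the toric census (hodgecm-mathlib-F0P3-p01 (g32) T5b memo §2): there the side scalar is `h₋ = h₊·n₀` with `n₀` a `Θ`-fixed NON-NORM unit, `(ρh₋∕h₋)·t(ω) =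
−ρ(n₀N)∕(n₀N)` (`N = ωΘω`), so the ρ-depth of the dual generator's unit part is `|n₀N − ρ(n₀N)|` and NO exact translator exists (★ `setOf_v_one_add_mul_twist_le_eq_smul` needs
`η·t(ω₀) = −1`).  THIS FILE: the depth set `D_r(n₀) = {ω : |ω| = 1, |n₀·ωΘω − ρ(n₀·ωΘω)| ≤ r}` is EITHER EMPTY OR A COSET — **`setOf_twistedNormDepth_le_eq_smul`**: if `ω₁ ∈ D_r(n₀)`
then `D_r(n₀) = ω₁·B_r` (`B_r = {|ω| = 1, |ωΘω − ρ(ωΘω)| ≤ r}` of ★ p857299) — depth is submultiplicative on unit products and stable under inversion.  With ★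
`QuadraticOrderNormDepthIndexTwo` §3 (RamK: `D_{exp(−c)}(n₀) ≠ ∅ ⟺ c + 2 ≤ 2d`) this gives the anisotropic level counts `[B_c : 𝒪_jˣ] − [B_{c+1} : 𝒪_jˣ]`, `[B_c : 𝒪_jˣ]`, `0`.
HONEST LABEL: HC_CM is proved only modulo the 7 printed citations (2 remaining named inputs: hLiu418 = stmt-HodgeConjecture-24832, h413 = stmt-HodgeConjecture-24833) until rung 0
closes; unconditional local algebra, count-neutral.

## References
* [Serre1979] J.-P. Serre, *Local Fields*, GTM 67 (1979): Ch. V §1 (unit filtration), §3.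
* [Jacobowitz1962] R. Jacobowitz, *Hermitian forms over local fields*, Amer. J. Math. 84 (1962): §4.
-/

set_option autoImplicit false

open WithZero
open scoped Pointwise Valued

namespace Literature.NumberTheory.LocalFields.QuadraticOrder

variable {K : Type*} [Field K] [Valued K ℤᵐ⁰] {ρ Θ : K →+* K}

/-- **TWISTED NORM-DEPTH SETS ARE COSETS (approximate translator)**: for a unit `n₀`, any radius `r`, and any unit `ω₁` with `|n₀N(ω₁) − ρ(n₀N(ω₁))| ≤ r` (`N(ω) = ωΘω`),
`{ω : |ω| = 1, |n₀N(ω) − ρ(n₀N(ω))| ≤ r} = ω₁·B_r`. (`ρ`, `Θ` isometric.) [cite: Serre1979, Ch. V §1] [cite: Jacobowitz1962, §4] -/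
theorem setOf_twistedNormDepth_le_eq_smul (hvρ : ∀ x, Valued.v (ρ x) = Valued.v x) (hvΘ : ∀ x, Valued.v (Θ x) = Valued.v x)
    {n₀ : K} (hn₀ : Valued.v n₀ = 1) (r : ℤᵐ⁰) {ω₁ : Kˣ} (hω₁ : Valued.v (ω₁ : K) = 1)
    (h₁ : Valued.v (n₀ * ((ω₁ : K) * Θ ω₁) - ρ (n₀ * ((ω₁ : K) * Θ ω₁))) ≤ r) {B : Subgroup Kˣ}
    (hB : ∀ ω : Kˣ, ω ∈ B ↔ Valued.v (ω : K) = 1 ∧ Valued.v ((ω : K) * Θ ω - ρ ((ω : K) * Θ ω)) ≤ r) :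
    {ω : Kˣ | Valued.v (ω : K) = 1 ∧ Valued.v (n₀ * ((ω : K) * Θ ω) - ρ (n₀ * ((ω : K) * Θ ω))) ≤ r} = ω₁ • (B : Set Kˣ) := by
  have hN1 : ∀ {ω : K}, Valued.v ω = 1 → Valued.v (ω * Θ ω) = 1 := fun hω => by rw [map_mul, hvΘ, hω, mul_one]
  have hnN1 : ∀ {ω : K}, Valued.v ω = 1 → Valued.v (n₀ * (ω * Θ ω)) = 1 := fun hω => by rw [map_mul, hn₀, hN1 hω, one_mul]
  have hsplit : ∀ ω ω' : Kˣ, n₀ * (((ω * ω' : Kˣ) : K) * Θ ((ω * ω' : Kˣ) : K)) = (n₀ * ((ω : K) * Θ ω)) * (((ω' : Kˣ) : K) * Θ ω') := fun ω ω' => by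
    rw [Units.val_mul, map_mul]; ring
  ext ω
  rw [Set.mem_setOf_eq, Set.mem_smul_set]
  constructor
  · rintro ⟨hω, hr⟩
    refine ⟨ω₁⁻¹ * ω, (hB _).2 ⟨?_, ?_⟩, by rw [smul_eq_mul, mul_inv_cancel_left]⟩
    · rw [Units.val_mul, Units.val_inv_eq_inv_val, map_mul, map_inv₀, hω₁, hω, inv_one, one_mul]
    · have heq : ((ω₁⁻¹ * ω : Kˣ) : K) * Θ ((ω₁⁻¹ * ω : Kˣ) : K) = (n₀ * ((ω : K) * Θ ω)) * (n₀ * ((ω₁ : K) * Θ ω₁))⁻¹ := by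
        have hn0 : n₀ ≠ 0 := fun h0 => by rw [h0, map_zero] at hn₀; exact zero_ne_one hn₀
        have hω₁0 : (ω₁ : K) ≠ 0 := ω₁.ne_zero
        have hΘω₁0 : Θ (ω₁ : K) ≠ 0 := (map_ne_zero Θ).2 hω₁0
        rw [Units.val_mul, Units.val_inv_eq_inv_val, map_mul, map_inv₀]; field_simp
      rw [heq]
      exact (v_mul_sub_map_mul_le hvρ (hnN1 hω) (by rw [map_inv₀, hnN1 hω₁, inv_one])).trans
        (max_le hr (by rw [v_inv_sub_map_inv hvρ (hnN1 hω₁)]; exact h₁))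
  · rintro ⟨ω', hω', rfl⟩
    obtain ⟨hω'1, hω'r⟩ := (hB ω').1 hω'
    refine ⟨by rw [smul_eq_mul, Units.val_mul, map_mul, hω₁, hω'1, mul_one], ?_⟩
    rw [smul_eq_mul, hsplit]
    exact (v_mul_sub_map_mul_le hvρ (hnN1 hω₁) (hN1 hω'1)).trans (max_le h₁ hω'r)

end Literature.NumberTheory.LocalFields.QuadraticOrder
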